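import Literature.Analysis.FluidPDE.RusinSverakCompactnessLeafAssembly
import Literature.Analysis.FluidPDE.LocalEnergyExtension
import Literature.Analysis.FluidPDE.LocalLerayWeakStrongProofs
import Literature.Analysis.FluidPDE.KatoLocalLerayPressureProofs
import Literature.Analysis.FluidPDE.LerayPressureDecayProofs
import Literature.Analysis.FluidPDE.LocalLerayPressureDecompositionProofs
import Literature.Analysis.FluidPDE.CKNEpsilonRegularityHolds
import Literature.Analysis.FluidPDE.RusinSverakSingularPointsStableLeaves
import Literature.Analysis.FluidPDE.JiaSverak2013AprioriEstimate
import Literature.Analysis.FluidPDE.LocalLerayLimitingProcedureProofs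
import HarnessLib

/-!
# Rusin–Šverák, Cor. 4.3, over the seven remaining leaves of its cone

Analysis/FluidPDE proof file (no definitions, no named facts) for the named fact
`Literature.Analysis.FluidPDE.rusin_sverak_minimal_data_compact` (`RusinSverakCompactness.lean`;
W. Rusin, V. Šverák, *Minimal initial data for potential Navier–Stokes singularities*,
J. Funct. Anal. 260 (2011) 879–891 = arXiv:0911.0500, **Cor. 4.3** p. 8, second clause: the set
`M` of `Ḣ^{1/2}`-minimal blow-up data is compact modulo scalings and translations; first clause
`rusin_sverak_minimal_blowup`, `RusinSverakMinimalData.lean`).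

The accepted assembly `rusin_sverak_minimal_data_compact_of_local_leray_leaves`
(`RusinSverakCompactnessLeafAssembly.lean`) derives Cor. 4.3 from five named facts of the local
Leray theory: **E** `leray_solution_exists_of_memLp_three`, **U**
`local_leray_weak_strong_uniqueness`, **A** `kato_isLocalLeraySolutionOn`, **F**
`leray_solution_farField_bound`, **S** `rusin_sverak_leray_singular_points_stable`. Since then the
tree has discharged **A** (`kato_isLocalLeraySolutionOn_holds`, `KatoLocalLerayPressureProofs.lean`),
the ε-regularity criterion (`lemarieRieusset_epsilon_regularity_holds`,
`CKNEpsilonRegularityHolds.lean`), the Calderón–Zygmund bound for the normalised pressure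
(`stein1970_normalisedPressure_ae_Lp_bound_holds`, `LocalLerayPressureDecompositionProofs.lean`),
Rusin–Šverák's Prop. 2.2 (`rusin_sverak_2011_proposition_2_2_holds`,
`LocalLerayLimitingProcedureProofs.lean`) and the two CKN inputs of **S**
(`RRS2016.step2_force_holds`, `RRS2016.lemma15_12_holds`), and has reduced the other four inputs:

* **E** `⇐ localLeraySolution_exists_of_memE2` (`leray_solution_exists_of_memLp_three_of_memE2`,
  `LocalLerayExistence.lean`) `⇐` local existence + extension for `E²` data
  (`localLeraySolution_exists_of_memE2_of_extension`, `LocalEnergyExtension.lean`);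
* **U** `⇐ local_leray_difference_energy_estimate` (`local_leray_weak_strong_uniqueness_of`,
  `LocalLerayWeakStrongProofs.lean`);
* **F** `⇐` ε-regularity + Kang–Miura–Tsai's pressure decomposition + the Calderón–Zygmund bound
  (`leray_solution_farField_bound_of_decomposition`, `LerayPressureDecayProofs.lean`);
* **S** `⇐` Jia–Šverák's Cor. 1 (`⇐` Lemma 2, `jia_sverak_2013_corollary_1_of_lemma_2`,
  `JiaSverak2013AprioriEstimate.lean`), Lemma 8, the limiting procedure (`⇐` Cor. 1, Prop. 2.2 and
  the limit step, `localLeray_limiting_procedure_of_facts`, `LocalLerayLimitingProcedure.lean`)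
  and the two CKN inputs (`rusin_sverak_leray_singular_points_stable_of_leaves`,
  `RusinSverakSingularPointsStableLeaves.lean`).

This file composes these reductions with the discharged theorems and records Cor. 4.3 (both
clauses) as a consequence of exactly the seven named facts of the cone that are still
undischarged (each a published theorem with its own locator, quoted in its file):

1. `localEnergySolution_exists_local_of_memE2` — local-in-time local energy solutions for `E²`
   data (Lemarié-Rieusset 2016 Thm. 14.1; Seregin 2014 Prop. 1.8), `LocalEnergyExtension.lean`;
2. `localEnergySolution_extension_of_memE2` — the extension step (Seregin 2014 App. B §B.5;
   Lemarié-Rieusset 2016 Thm. 14.8, proof, Steps 1–3), `LocalEnergyExtension.lean`;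
3. `local_leray_difference_energy_estimate` — the local energy estimate for the difference of
   two local Leray solutions (Lemarié-Rieusset 2016 Thm. 14.7, proof, pp. 515–518),
   `LocalLerayWeakStrongProofs.lean`;
4. `kangMiuraTsai_pressure_decomposition` — the local pressure decomposition of local Leray
   solutions (Kang–Miura–Tsai 2021 Lemma 3.4 = Kikuchi–Seregin 2007 Def. 1.1),
   `LocalLerayPressureDecomposition.lean`;
5. `jia_sverak_2013_lemma_2` — the a-priori local energy estimate for local Leray solutions
   (Jia–Šverák 2013 Lemma 2 with (2.9); Kang–Miura–Tsai 2021 Lemma 3.5),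
   `JiaSverak2013AprioriEstimate.lean`;
6. `jia_sverak_2013_lemma_8` — the uniform initial layer (Jia–Šverák 2013 Lemma 8;
   Lemarié-Rieusset 2016 Prop. 15.1), `JiaSverak2013Compactness.lean`;
7. `localLeray_limit_isLocalLeraySolution` — the limit of local Leray solutions is a local Leray
   solution with the weak-limit datum (Jia–Šverák 2013, proof of Thm. 1, p. 8; Lemarié-Rieusset
   2016, proof of Thm. 15.5), `LocalLerayLimitingProcedure.lean`.

So `rusin_sverak_minimal_data_compact_holds` is `rusin_sverak_minimal_data_compact_of_seven_leaves`
applied to the seven `_holds` theorems once they exist; the file also merges, already now, the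
import closures of the four sub-cones (local energy existence, weak–strong uniqueness, pressure
decay / ε-regularity, Jia–Šverák compactness) with the Kato-side assembly, so that the final
discharge is a one-line file over this one.

## References

* W. Rusin, V. Šverák, J. Funct. Anal. 260 (2011) 879–891 = arXiv:0911.0500, Cor. 4.3 and its
  proof (p. 8), Thm. 4.1, Thm. 4.2, Cor. 4.2, Prop. 2.2, Lemma 2.1. [RusinSverak2011]
* P. G. Lemarié-Rieusset, *The Navier–Stokes Problem in the 21st Century*, CRC Press 2016,
  doi:10.1201/b19556, Thms. 14.1, 14.4, 14.7, 14.8, 15.1. [LemarieRieusset2016]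
* H. Jia, V. Šverák, *Minimal L³-initial data for potential Navier–Stokes singularities*,
  SIAM J. Math. Anal. 45 (2013) 1448–1459 = arXiv:1201.1592, Lemma 2, Cor. 1, Lemma 8, proof of
  Thm. 1. [JiaSverak2013]
* K. Kang, H. Miura, T.-P. Tsai, Int. Math. Res. Not. 2021 = arXiv:1812.10509, Lemmas 3.3–3.5.
  [KangMiuraTsai2020]
* G. Seregin, *Lecture Notes on Regularity Theory for the Navier–Stokes Equations*, World
  Scientific 2014, App. B, Prop. 1.8 and §B.5. [Seregin2014Notes]
-/

noncomputable section

namespace Literature.Analysis.FluidPDE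

/-- **Rusin–Šverák, Cor. 4.3, second clause, over the seven undischarged leaves of its cone.**
The compactness modulo scalings and translations of the set of minimal blow-up data
(`rusin_sverak_minimal_data_compact`) follows from local existence (1) and extension (2) of local
energy solutions with `E²` data, the difference energy estimate behind weak–strong uniqueness (3),
the local pressure decomposition (4), Jia–Šverák's Lemma 2 (5) and Lemma 8 (6), and the limit
step of the local Leray limiting procedure (7); every other input of the printed proof
(Kato's local theory and continuation, ε-regularity, RRS Lemma 15.12 / Step 2, Prop. 2.2, the
Calderón–Zygmund pressure bound, the local Leray property of Kato solutions) is a theorem of the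
tree and is plugged in here. [cite: RusinSverak2011, Cor. 4.3 and its proof (arXiv:0911.0500 p. 8)] -/
theorem rusin_sverak_minimal_data_compact_of_seven_leaves
    (h₁ : localEnergySolution_exists_local_of_memE2)
    (h₂ : localEnergySolution_extension_of_memE2)
    (h₃ : local_leray_difference_energy_estimate)
    (h₄ : kangMiuraTsai_pressure_decomposition)
    (h₅ : jia_sverak_2013_lemma_2) (h₆ : jia_sverak_2013_lemma_8)
    (h₇ : localLeray_limit_isLocalLeraySolution) : rusin_sverak_minimal_data_compact :=
  rusin_sverak_minimal_data_compact_of_local_leray_leaves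
    (leray_solution_exists_of_memLp_three_of_memE2
      (localLeraySolution_exists_of_memE2_of_extension h₁ h₂))
    (local_leray_weak_strong_uniqueness_of h₃) kato_isLocalLeraySolutionOn_holds
    (leray_solution_farField_bound_of_decomposition lemarieRieusset_epsilon_regularity_holds h₄
      stein1970_normalisedPressure_ae_Lp_bound_holds)
    (rusin_sverak_leray_singular_points_stable_of_leaves (jia_sverak_2013_corollary_1_of_lemma_2 h₅)
      h₆ (localLeray_limiting_procedure_of_facts (jia_sverak_2013_corollary_1_of_lemma_2 h₅)
        rusin_sverak_2011_proposition_2_2_holds h₇)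
      RRS2016.step2_force_holds RRS2016.lemma15_12_holds)

/-- **Rusin–Šverák, Cor. 4.3, first clause, over the same seven leaves** (`rusin_sverak_minimal_blowup`:
minimal blow-up data exist when `ρ_max < ∞`), through
`rusin_sverak_minimal_blowup_of_local_leray_leaves` with the same discharged inputs.
[cite: RusinSverak2011, Cor. 4.3 and its proof (arXiv:0911.0500 p. 8)] -/
theorem rusin_sverak_minimal_blowup_of_seven_leaves
    (h₁ : localEnergySolution_exists_local_of_memE2)
    (h₂ : localEnergySolution_extension_of_memE2)
    (h₃ : local_leray_difference_energy_estimate)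
    (h₄ : kangMiuraTsai_pressure_decomposition)
    (h₅ : jia_sverak_2013_lemma_2) (h₆ : jia_sverak_2013_lemma_8)
    (h₇ : localLeray_limit_isLocalLeraySolution) : rusin_sverak_minimal_blowup :=
  rusin_sverak_minimal_blowup_of_local_leray_leaves
    (leray_solution_exists_of_memLp_three_of_memE2
      (localLeraySolution_exists_of_memE2_of_extension h₁ h₂))
    (local_leray_weak_strong_uniqueness_of h₃) kato_isLocalLeraySolutionOn_holds
    (leray_solution_farField_bound_of_decomposition lemarieRieusset_epsilon_regularity_holds h₄
      stein1970_normalisedPressure_ae_Lp_bound_holds)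
    (rusin_sverak_leray_singular_points_stable_of_leaves (jia_sverak_2013_corollary_1_of_lemma_2 h₅)
      h₆ (localLeray_limiting_procedure_of_facts (jia_sverak_2013_corollary_1_of_lemma_2 h₅)
        rusin_sverak_2011_proposition_2_2_holds h₇)
      RRS2016.step2_force_holds RRS2016.lemma15_12_holds)

end Literature.Analysis.FluidPDE

end
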